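import Summits.Ventures.PercRepro.C026ThreeCells

/-!
# Bit-planes for the 6-vertex gadget, V: the gadget theorem (p5, gen 13)

Fibres of the state map are constant on cells (a transport bijection); counting the three events of
`dFreeIneq_iff_hGraph` by fibres and cells, the kernel table gives the D-free inequality on every
multigraph supported on six vertices with every edge at a non-mark.
-/

namespace PercRepro

namespace MultiGraph
open PairModel Plane6

variable {V E : Type*} {G : MultiGraph V E} {ι : ℕ → V}
variable (hinj : InjBelow ι 6)
variable (hnm : ∀ e, ∃ k, 3 ≤ k ∧ k < 6 ∧ (G.fst e = ι k ∨ G.snd e = ι k))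
variable (hsup : G.Supported ι 6)
include hinj hnm hsup

/-! ### VII. Fibres of the state map are constant on cells (the transport bijection) -/

omit hinj hnm hsup in
/-- The pair of a class has that class (in both orders), its vertices are below `6` and distinct (by `decide`). -/
theorem cls_clsU_clsV : ∀ c : ℕ, c < 12 →
    Plane6.cls (clsU c) (clsV c) = some c ∧ Plane6.cls (clsV c) (clsU c) = some c ∧
      clsU c < 6 ∧ clsV c < 6 ∧ clsU c ≠ clsV c := by
  decide

omit hinj hnm hsup in
open Classical in
/-- The index of a supported vertex (any index for an unsupported one). -/
noncomputable def vidx (ι : ℕ → V) (v : V) : ℕ :=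
  if h : ∃ k, k < 6 ∧ ι k = v then Classical.choose h else 0

omit hinj hnm hsup in
open Classical in
/-- The index of a supported vertex is below `6` and indexes it. -/
theorem vidx_spec {v : V} (h : ∃ k, k < 6 ∧ ι k = v) : vidx ι v < 6 ∧ ι (vidx ι v) = v := by
  unfold vidx
  rw [dif_pos h]
  exact Classical.choose_spec h

omit hnm hsup in
/-- The index of `ι k` is `k` (for `k < 6`, by injectivity). -/
theorem vidx_iota {k : ℕ} (hk : k < 6) : vidx ι (ι k) = k := by
  have h : ∃ k', k' < 6 ∧ ι k' = ι k := ⟨k, hk, rfl⟩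
  obtain ⟨h1, h2⟩ := vidx_spec h
  exact hinj _ h1 _ hk h2

omit hinj hnm hsup in
/-- The class of an edge. -/
noncomputable def edgeCls (G : MultiGraph V E) (ι : ℕ → V) (e : E) : Option ℕ :=
  Plane6.cls (vidx ι (G.fst e)) (vidx ι (G.snd e))

omit hinj hnm hsup in
/-- Transport between fibres: on the edges of every class present (digit `1`) in `t`, every copy is set to
the open bit of `u`; every other edge keeps its value. -/
noncomputable def transport (G : MultiGraph V E) (ι : ℕ → V) (t u : ℕ) (ω : Config E) : Config E := fun e =>
  match G.edgeCls ι e with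
  | some c => if dig c t = 1 then u.testBit c else ω e
  | none => ω e

omit hnm in
/-- An edge of class `c` joins the class's pair. -/
theorem joins_of_edgeCls {e : E} {c : ℕ} (hc : G.edgeCls ι e = some c) :
    c < 12 ∧ G.Joins e (ι (clsU c)) (ι (clsV c)) := by
  unfold edgeCls at hc
  obtain ⟨hf, hs⟩ := hsup e
  obtain ⟨i, hi, hfi⟩ := hf
  obtain ⟨j, hj, hsj⟩ := hs
  rw [hfi, hsj, vidx_iota hinj hi, vidx_iota hinj hj] at hc
  have hok := clsOK_all i hi j hj
  unfold clsOK at hok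
  rw [hc] at hok
  simp only [Bool.and_eq_true, decide_eq_true_eq, Bool.or_eq_true, beq_iff_eq] at hok
  obtain ⟨hc12, h⟩ := hok
  refine ⟨hc12, ?_⟩
  rcases h with ⟨h1, h2⟩ | ⟨h1, h2⟩
  · rw [h1, h2]; exact Or.inl ⟨hfi, hsj⟩
  · rw [h1, h2]; exact Or.inr ⟨hfi, hsj⟩

omit hnm hsup in
/-- An edge joining the pair of class `c` has class `c`. -/
theorem edgeCls_of_joins {e : E} {c : ℕ} (hc : c < 12) (h : G.Joins e (ι (clsU c)) (ι (clsV c))) :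
    G.edgeCls ι e = some c := by
  obtain ⟨h1, h2, hu, hv, _⟩ := cls_clsU_clsV c hc
  unfold edgeCls
  rcases h with ⟨hf, hs⟩ | ⟨hf, hs⟩
  · rw [hf, hs, vidx_iota hinj hu, vidx_iota hinj hv, h1]
  · rw [hf, hs, vidx_iota hinj hv, vidx_iota hinj hu, h2]

omit hinj hnm hsup in
/-- The open bit of class `c` of the state of `ω`: some open edge joins the class's pair. -/
theorem testBit_stateOf_iff_open (ω : Config E) {c : ℕ} (hc : c < 12) :
    (G.stateOf (ι := ι) ω).testBit c = true ↔ ∃ e, ω e = true ∧ G.Joins e (ι (clsU c)) (ι (clsV c)) := by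
  obtain ⟨_, _, hu, hv, hne⟩ := cls_clsU_clsV c hc
  rw [testBit_stateOf_lo ω hc, adj_oRows ω hu]
  constructor
  · rintro ⟨_, _, e, he, hj⟩; exact ⟨e, he, hj⟩
  · rintro ⟨e, he, hj⟩; exact ⟨hv, hne, e, he, hj⟩

omit hinj hnm hsup in
/-- The closed bit of class `c` of the state of `ω`: some closed edge joins the class's pair. -/
theorem testBit_stateOf_iff_closed (ω : Config E) {c : ℕ} (hc : c < 12) :
    (G.stateOf (ι := ι) ω).testBit (12 + c) = true ↔
      ∃ e, ω e = false ∧ G.Joins e (ι (clsU c)) (ι (clsV c)) := by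
  obtain ⟨_, _, hu, hv, hne⟩ := cls_clsU_clsV c hc
  rw [testBit_stateOf_hi ω hc, adj_cRows ω hu]
  constructor
  · rintro ⟨_, _, e, he, hj⟩; exact ⟨e, he, hj⟩
  · rintro ⟨e, he, hj⟩; exact ⟨hv, hne, e, he, hj⟩

omit hnm in
/-- In a configuration whose state has digit `1` at class `c`, every edge of class `c` carries the open
bit of the state. -/
theorem val_of_dig_one {ω : Config E} {t : ℕ} (hω : G.stateOf (ι := ι) ω = t) {e : E} {c : ℕ}
    (hc : G.edgeCls ι e = some c) (hd : dig c t = 1) : ω e = t.testBit c := by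
  obtain ⟨hc12, hj⟩ := joins_of_edgeCls hinj hsup hc
  have ho := testBit_stateOf_iff_open (G := G) (ι := ι) ω hc12
  have hcl := testBit_stateOf_iff_closed (G := G) (ι := ι) ω hc12
  rw [hω] at ho hcl
  unfold dig at hd
  rcases Bool.eq_false_or_eq_true (ω e) with he | he
  · rw [he, ho.2 ⟨e, he, hj⟩]
  · have h2 : t.testBit (12 + c) = true := hcl.2 ⟨e, he, hj⟩
    rcases Bool.eq_false_or_eq_true (t.testBit c) with h | h
    · rw [h, h2] at hd; simp at hd
    · rw [he, h]

omit hinj hnm hsup in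
/-- A present class has exactly one of its two bits. -/
theorem closed_of_dig_one {c u : ℕ} (h : dig c u = 1) : u.testBit (12 + c) = !u.testBit c := by
  unfold dig at h
  rcases Bool.eq_false_or_eq_true (u.testBit c) with h1 | h1 <;>
    rcases Bool.eq_false_or_eq_true (u.testBit (12 + c)) with h2 | h2 <;> simp_all

omit hnm hsup in
/-- The transport of a configuration of state `t` has state `u` when `t` and `u` are in the same cell. -/
theorem stateOf_transport {ω : Config E} {t u : ℕ} (hω : G.stateOf (ι := ι) ω = t) (hu : u < NS)
    (hcell : SameCell t u) : G.stateOf (ι := ι) (G.transport ι t u ω) = u := by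
  apply Nat.eq_of_testBit_eq
  intro j
  by_cases hj24 : 24 ≤ j
  · rw [Nat.testBit_lt_two_pow (lt_of_lt_of_le (stateOf_lt _) (Nat.pow_le_pow_right (by norm_num) hj24)),
      Nat.testBit_lt_two_pow (lt_of_lt_of_le hu (Nat.pow_le_pow_right (by norm_num) hj24))]
  have key : ∀ c, c < 12 →
      ((G.stateOf (ι := ι) (G.transport ι t u ω)).testBit c = u.testBit c ∧
        (G.stateOf (ι := ι) (G.transport ι t u ω)).testBit (12 + c) = u.testBit (12 + c)) := by
    intro c hc
    have hdig := hcell c hc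
    have hoT := testBit_stateOf_iff_open (G := G) (ι := ι) (G.transport ι t u ω) hc
    have hcT := testBit_stateOf_iff_closed (G := G) (ι := ι) (G.transport ι t u ω) hc
    have hoω := testBit_stateOf_iff_open (G := G) (ι := ι) ω hc
    have hcω := testBit_stateOf_iff_closed (G := G) (ι := ι) ω hc
    rw [hω] at hoω hcω
    by_cases hd : dig c t = 1
    · have hdu : dig c u = 1 := by rw [← hdig]; exact hd
      have hval : ∀ e, G.Joins e (ι (clsU c)) (ι (clsV c)) → G.transport ι t u ω e = u.testBit c := by
        intro e he
        unfold transport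
        rw [edgeCls_of_joins hinj hc he]
        simp [hd]
      have hex : ∃ e, G.Joins e (ι (clsU c)) (ι (clsV c)) := by
        rcases Bool.eq_false_or_eq_true (t.testBit c) with h | h
        · obtain ⟨e, _, hj⟩ := hoω.1 h
          exact ⟨e, hj⟩
        · have h2 : t.testBit (12 + c) = true := by
            unfold dig at hd
            rcases Bool.eq_false_or_eq_true (t.testBit (12 + c)) with h2 | h2
            · exact h2
            · rw [h, h2] at hd; simp at hd
          obtain ⟨e, _, hj⟩ := hcω.1 h2
          exact ⟨e, hj⟩
      obtain ⟨e₀, he₀⟩ := hex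
      have hcu : u.testBit (12 + c) = !u.testBit c := closed_of_dig_one hdu
      constructor
      · rw [Bool.eq_iff_iff, hoT]
        constructor
        · rintro ⟨e, hT, hj⟩; rw [hval e hj] at hT; exact hT
        · intro h; exact ⟨e₀, by rw [hval e₀ he₀]; exact h, he₀⟩
      · rw [Bool.eq_iff_iff, hcT, hcu]
        constructor
        · rintro ⟨e, hT, hj⟩; rw [hval e hj] at hT; simp [hT]
        · intro h; exact ⟨e₀, by rw [hval e₀ he₀]; simpa using h, he₀⟩
    · have hval : ∀ e, G.Joins e (ι (clsU c)) (ι (clsV c)) → G.transport ι t u ω e = ω e := by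
        intro e he
        unfold transport
        rw [edgeCls_of_joins hinj hc he]
        simp [hd]
      have hbits : t.testBit c = u.testBit c ∧ t.testBit (12 + c) = u.testBit (12 + c) := by
        unfold dig at hdig hd
        rcases Bool.eq_false_or_eq_true (t.testBit c) with h1 | h1 <;>
          rcases Bool.eq_false_or_eq_true (t.testBit (12 + c)) with h2 | h2 <;>
          rcases Bool.eq_false_or_eq_true (u.testBit c) with h3 | h3 <;>
          rcases Bool.eq_false_or_eq_true (u.testBit (12 + c)) with h4 | h4 <;>
          simp_all
      constructor
      · rw [Bool.eq_iff_iff, hoT, ← hbits.1, hoω]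
        constructor
        · rintro ⟨e, hT, hj⟩; exact ⟨e, by rw [← hval e hj]; exact hT, hj⟩
        · rintro ⟨e, hT, hj⟩; exact ⟨e, by rw [hval e hj]; exact hT, hj⟩
      · rw [Bool.eq_iff_iff, hcT, ← hbits.2, hcω]
        constructor
        · rintro ⟨e, hT, hj⟩; exact ⟨e, by rw [← hval e hj]; exact hT, hj⟩
        · rintro ⟨e, hT, hj⟩; exact ⟨e, by rw [hval e hj]; exact hT, hj⟩
  by_cases hj : j < 12
  · exact (key j hj).1
  · obtain ⟨c, rfl⟩ : ∃ c, j = 12 + c := ⟨j - 12, by omega⟩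
    exact (key c (by omega)).2

omit hnm in
/-- The transport is injective on a fibre. -/
theorem transport_injOn {t u : ℕ} {ω₁ ω₂ : Config E} (h1 : G.stateOf (ι := ι) ω₁ = t)
    (h2 : G.stateOf (ι := ι) ω₂ = t) (h : G.transport ι t u ω₁ = G.transport ι t u ω₂) : ω₁ = ω₂ := by
  funext e
  have he := congrFun h e
  unfold transport at he
  cases hc : G.edgeCls ι e with
  | none => rw [hc] at he; exact he
  | some c =>
    rw [hc] at he
    by_cases hd : dig c t = 1
    · rw [val_of_dig_one hinj hsup h1 hc hd, val_of_dig_one hinj hsup h2 hc hd]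
    · simp only [hd, if_false] at he; exact he

section Count

variable [Fintype E] [DecidableEq E]

omit hinj hnm hsup in
/-- The fibre of the state map. -/
noncomputable def fib (G : MultiGraph V E) (ι : ℕ → V) (t : ℕ) : ℕ :=
  (Finset.univ.filter fun ω : Config E => G.stateOf (ι := ι) ω = t).card

omit hnm in
/-- **Fibres are constant on cells.** -/
theorem fib_eq_of_sameCell {t u : ℕ} (ht : t < NS) (hu : u < NS) (hcell : SameCell t u) :
    G.fib ι t = G.fib ι u := by
  have hcell' : SameCell u t := fun i hi => (hcell i hi).symm
  apply le_antisymm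
  · apply Finset.card_le_card_of_injOn (G.transport ι t u)
    · intro ω hω
      simp only [Finset.coe_filter, Finset.mem_univ, true_and, Set.mem_setOf_eq] at hω ⊢
      exact stateOf_transport hinj hω hu hcell
    · intro ω₁ hω₁ ω₂ hω₂ h
      simp only [Finset.coe_filter, Finset.mem_univ, true_and, Set.mem_setOf_eq] at hω₁ hω₂
      exact transport_injOn hinj hsup hω₁ hω₂ h
  · apply Finset.card_le_card_of_injOn (G.transport ι u t)
    · intro ω hω
      simp only [Finset.coe_filter, Finset.mem_univ, true_and, Set.mem_setOf_eq] at hω ⊢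
      exact stateOf_transport hinj hω ht hcell'
    · intro ω₁ hω₁ ω₂ hω₂ h
      simp only [Finset.coe_filter, Finset.mem_univ, true_and, Set.mem_setOf_eq] at hω₁ hω₂
      exact transport_injOn hinj hsup hω₁ hω₂ h

omit hinj hnm hsup in
/-- Counting a state predicate over the configurations by fibres. -/
theorem card_filter_state (P : ℕ → Bool) :
    (Finset.univ.filter fun ω : Config E => P (G.stateOf (ι := ι) ω) = true).card =
      ∑ t ∈ Finset.range NS, if P t = true then G.fib ι t else 0 := by
  rw [Finset.card_eq_sum_card_fiberwise (f := fun ω => G.stateOf (ι := ι) ω) (t := Finset.range NS)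
    (fun ω _ => Finset.mem_range.2 (stateOf_lt ω))]
  apply Finset.sum_congr rfl
  intro t _
  by_cases hP : P t = true
  · rw [if_pos hP]
    unfold fib
    congr 1
    ext ω
    simp only [Finset.mem_filter, Finset.mem_univ, true_and]
    constructor
    · rintro ⟨_, h⟩; exact h
    · intro h; exact ⟨by rw [h]; exact hP, h⟩
  · rw [if_neg hP, Finset.card_eq_zero, Finset.filter_eq_empty_iff]
    intro ω hω
    simp only [Finset.mem_filter, Finset.mem_univ, true_and] at hω
    intro h
    rw [h] at hω
    exact hP hω

/-! ### VIII. The gadget theorem -/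

/-- **The D-free inequality on a graph supported on six vertices with every edge at a non-mark**, from
the kernel table of the cell coefficients. -/
theorem dFreeIneq_of_supported6
    (htable : ltP (levels 12 [bot &&& (o1 ^^^ o2), bot &&& (o1 &&& o2)]) (levels 12 [bot &&& BAD]) 0
      &&& valid = 0) :
    G.DFreeIneq (ι 0) (ι 1) (ι 2) := by
  classical
  rw [dFreeIneq_iff_hGraph]
  have e1 : (Finset.univ.filter fun ω : Config E => G.IsBot ω (ι 0) (ι 1) (ι 2) ∧ G.HConn ω (ι 2) (ι 0) (ι 1)) =
      Finset.univ.filter fun ω : Config E => (bot &&& BAD).testBit (G.stateOf (ι := ι) ω) = true := by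
    ext ω
    simp only [Finset.mem_filter, Finset.mem_univ, true_and, Nat.testBit_and, Bool.and_eq_true,
      isBot_iff_bit hinj hnm hsup, hConn_iff_bit hinj hnm hsup]
  have e2 : (Finset.univ.filter fun ω : Config E =>
      G.IsBot ω (ι 0) (ι 1) (ι 2) ∧ G.HConnAvoid ω (ι 2) (G.cluster ω (ι 1)) (ι 2) (ι 0)) =
      Finset.univ.filter fun ω : Config E => (bot &&& o1).testBit (G.stateOf (ι := ι) ω) = true := by
    ext ω
    simp only [Finset.mem_filter, Finset.mem_univ, true_and, Nat.testBit_and, Bool.and_eq_true,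
      isBot_iff_bit hinj hnm hsup, o1_iff_bit hinj hnm hsup]
  have e3 : (Finset.univ.filter fun ω : Config E =>
      G.IsBot ω (ι 0) (ι 1) (ι 2) ∧ G.HConnAvoid ω (ι 2) (G.cluster ω (ι 0)) (ι 2) (ι 1)) =
      Finset.univ.filter fun ω : Config E => (bot &&& o2).testBit (G.stateOf (ι := ι) ω) = true := by
    ext ω
    simp only [Finset.mem_filter, Finset.mem_univ, true_and, Nat.testBit_and, Bool.and_eq_true,
      isBot_iff_bit hinj hnm hsup, o2_iff_bit hinj hnm hsup]
  rw [e1, e2, e3, card_filter_state, card_filter_state, card_filter_state, ← Finset.sum_add_distrib]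
  have hm : ∀ t, (if (bot &&& BAD).testBit t = true then G.fib ι t else 0) =
      G.fib ι t * valAt [bot &&& BAD] t := by
    intro t
    rw [valAt_one, Nat.testBit_and]
    rcases Bool.eq_false_or_eq_true (bot.testBit t) with h1 | h1 <;>
      rcases Bool.eq_false_or_eq_true (BAD.testBit t) with h2 | h2 <;> simp [h1, h2]
  have hp : ∀ t, ((if (bot &&& o1).testBit t = true then G.fib ι t else 0) +
      (if (bot &&& o2).testBit t = true then G.fib ι t else 0)) =
      G.fib ι t * valAt [bot &&& (o1 ^^^ o2), bot &&& (o1 &&& o2)] t := by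
    intro t
    rw [valAt_two, Nat.testBit_and, Nat.testBit_and]
    rcases Bool.eq_false_or_eq_true (bot.testBit t) with h1 | h1 <;>
      rcases Bool.eq_false_or_eq_true (o1.testBit t) with h2 | h2 <;>
      rcases Bool.eq_false_or_eq_true (o2.testBit t) with h3 | h3 <;> simp [h1, h2, h3, mul_two]
  simp only [hm, hp]
  have hreps : ∀ g : ℕ → ℕ, ∑ t ∈ Finset.range NS, g t =
      ∑ s ∈ (Finset.range NS).filter (fun s => valid.testBit s = true), ∑ t ∈ expand 12 s, g t := by
    intro g
    rw [← Finset.sum_fiberwise_of_maps_to (g := rep) (t := (Finset.range NS).filter fun s => valid.testBit s = true)]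
    · apply Finset.sum_congr rfl
      intro s hs
      simp only [Finset.mem_filter, Finset.mem_range] at hs
      congr 1
      ext t
      simp only [Finset.mem_filter, Finset.mem_range, mem_expand_iff hs.1 hs.2]
      constructor
      · rintro ⟨ht, hr⟩
        refine ⟨ht, sameCell_of_rep_eq ?_⟩
        rw [hr, rep_self hs.1 hs.2]
      · rintro ⟨ht, hc⟩
        refine ⟨ht, ?_⟩
        rw [rep_eq_of_sameCell hc, rep_self hs.1 hs.2]
    · intro t _
      simp only [Finset.mem_filter, Finset.mem_range]
      exact ⟨rep_lt t, rep_valid t⟩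
  rw [hreps, hreps]
  apply Finset.sum_le_sum
  intro s hs
  simp only [Finset.mem_filter, Finset.mem_range] at hs
  have hconst : ∀ t ∈ expand 12 s, G.fib ι t = G.fib ι s := by
    intro t ht
    rw [mem_expand_iff hs.1 hs.2] at ht
    exact fib_eq_of_sameCell hinj hsup ht.1 hs.1 ht.2
  have hl : ∑ t ∈ expand 12 s, G.fib ι t * valAt [bot &&& BAD] t =
      G.fib ι s * ∑ t ∈ expand 12 s, valAt [bot &&& BAD] t := by
    rw [Finset.mul_sum]
    apply Finset.sum_congr rfl
    intro t ht
    rw [hconst t ht]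
  have hr : ∑ t ∈ expand 12 s, G.fib ι t * valAt [bot &&& (o1 ^^^ o2), bot &&& (o1 &&& o2)] t =
      G.fib ι s * ∑ t ∈ expand 12 s, valAt [bot &&& (o1 ^^^ o2), bot &&& (o1 &&& o2)] t := by
    rw [Finset.mul_sum]
    apply Finset.sum_congr rfl
    intro t ht
    rw [hconst t ht]
  rw [hl, hr]
  exact Nat.mul_le_mul_left _ (cell_le_of_ltP_eq_zero htable hs.1 hs.2)

end Count

/-- **The three-non-mark gadget theorem**: the D-free inequality on every multigraph supported on six
vertices (marks `ι 0, ι 1, ι 2`, non-marks `ι 3, ι 4, ι 5`) with every edge at a non-mark. -/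
theorem dFreeIneq_of_supported6' [Fintype E] [DecidableEq E] : G.DFreeIneq (ι 0) (ι 1) (ι 2) :=
  dFreeIneq_of_supported6 hinj hnm hsup Plane6.table

end MultiGraph

end PercRepro
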